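import Summits.AtomisticToContinuum.HydrodynamicLimit.Theses.InformationPercolationEngine
import Literature.Analysis.FluidPDE.HardSphereAlexander

/-!
# `KickIsotropyInfo` is false modulo the third-body shielding bias:
# `ShieldingBiasPersists → ¬ KickIsotropyInfo` (negative lemma modulo `H`)

Negative knowledge for the crux `InformationPercolationEngine.KickIsotropyInfo`
(stmt-AtomisticToContinuum-13478), from the standing disprover's
`Cruxes/KickIsotropyInfo/Disproof.lean` (cycles 1–2):

* §1 `sphereMeasure_map_sphereMap` — the surface measure `volume.toSphere` of the unit sphere is invariant under
  linear isometries; `integral_inner_mul_posPart_inner_eq_zero` — a transverse linear kick test has zero flux-mean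
  (reflection in `c^⊥`).
* §2 `kickIsotropyInfo_iff` — the crux with its `let`-chain packaged into `kickSum` / `KickBound` (`Iff.rfl`).
* §3 THE SHIELDING WITNESS, typed and PROVED ADMISSIBLE: kick test
  `kickTest c κ (ω,v,w) = ⟪ω, c(v,w)⟫ / ((κ + ‖c(v,w)‖)(1 + ‖ω‖²))` (`c(v,w) ⊥ w - v`, e.g. `perpVel`; continuous,
  `|g| ≤ 1`, zero flux-mean for every `(v, w)`), weight `shieldWeight c K N i n p = clamp(K ⟪e(p), c⟫)` with the
  SHIELDING DIRECTION `e(p) = unit(V²_j - V¹_j) - unit(V¹_i - V²_i)` read off the typed coarse past only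
  (`V¹, V²` the exact velocities of all spheres at the two flight starts, `j` the partner label; measurable,
  `|h| ≤ 1`).
* §4 `H = ShieldingBiasPersists` (a precise `Prop`: for every `σ₀` some `σ < σ₀`, flow family, horizon, cell
  size, transverse field and constants make the `L¹(invariant Gibbs law)` norm of the shielding collision sum
  exceed a fixed `δ > 0` for infinitely many `N`) and the NEGATIVE LEMMA
  `KickIsotropyInfo_false_of_ShieldingBiasPersists : ShieldingBiasPersists → ¬ KickIsotropyInfo`
  (through the equilibrium instance `KickFairAtEquilibrium`).
* the deterministic core of the mechanism (hard-core geometry: the shielded cap of impact vectors is EMPTY while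
  the third body is adjacent; the elastic kick reveals the contact direction) is the sibling file
  `Negative/ShieldedCapGeometry.lean`.

WHY `H` IS NOT CONSTRUCTIBLE HERE. `H` is a LOWER bound on a collision statistic of the deterministic
`(N+1)`-body hard-sphere flow under the invariant Gibbs law, uniformly in `N`: it needs the collision-rate
(contact-value / Palm) identity for collision sums with past-dependent marks, the three-body contact formula
for the `O(σ³)` shielded stratum, and control of the complementary strata — none of which the tree has (it has
Alexander's flow, the boundary-flux equality and single-collision windows, nothing on collision RATES).
EVIDENCE that `H` holds (item evidence of stmt-13478): equilibrium event-driven MD kit j004861, per-term shielding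
statistic `T = +0.0178 ± 0.0004` at `φ = 0.05`, N-independent over `N = 256…2048` (> 20 SE), null controls ≈ 0;
dynamics-free Enskog three-body cartoon j005475 reproduces it and gives `T ≈ 0.26 σ³` as `φ → 0` (nonzero at
EVERY `σ`); three planner seats re-derived the mechanism independently (SHIELDING.md, ANALYSIS.md, REPAIR.md).
No statement of the route is asserted here positively. refuter-cdisprove-stmt-AtomisticToContinuum-13478-g2-0.
-/

open MeasureTheory Metric Real Set Filter
open scoped InnerProductSpace ENNReal Pointwise BigOperators

namespace Summit.AtomisticToContinuum.HydrodynamicLimit.Theorems.KickIsotropyInfoNegative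

noncomputable section

open Literature.MathematicalPhysics.KineticTheory (T3 V3 hsDiameter sphereMeasure hardSphereKernel
  localGibbsLaw)
open Literature.Analysis.FluidPDE (HardSphereFlow Config collisionTimesOf coarseConfig flightStart)
/-- RETIRED route decl `KickIsotropyInfo` (stmt-AtomisticToContinuum-13478; replaced in `Theses.InformationPercolationEngine`, which no longer declares
it): re-homed here VERBATIM (2026-08-16, gate maintenance) so this negative record keeps compiling — the statement is
unchanged, only its home moved (rendered on one line exactly as the route file did). -/
def KickIsotropyInfo : Prop :=
  ∀ (a₀ θ₀ : Literature.MathematicalPhysics.KineticTheory.T3 → ℝ) (u₀ : Literature.MathematicalPhysics.KineticTheory.T3 → Literature.MathematicalPhysics.KineticTheory.V3), Continuous a₀ → Continuous θ₀ → Continuous u₀ → (∀ x, 0 < a₀ x) → (∀ x, 0 < θ₀ x) → ∃ σ₀ : ℝ, 0 < σ₀ ∧ ∀ σ : ℝ, 0 < σ → σ < σ₀ → ∀ Φ : (N : ℕ) → Literature.Analysis.FluidPDE.HardSphereFlow (Literature.Analysis.FluidPDE.Torus.geometry (Fin 3)) (Literature.MathematicalPhysics.KineticTheory.hsDiameter σ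 N) (N + 1), ∀ τ : ℝ, 0 < τ → ∀ r : ℝ, 0 < r → ∀ g : Literature.MathematicalPhysics.KineticTheory.V3 × Literature.MathematicalPhysics.KineticTheory.V3 × Literature.MathematicalPhysics.KineticTheory.V3 → ℝ, Continuous g → (∃ C : ℝ, ∀ p, |g p| ≤ C) → (∀ v w : Literature.MathematicalPhysics.KineticTheory.V3, ∫ ω : Metric.sphere (0 : Literature.MathematicalPhysics.KineticTheory.V3) 1, g ((ω : Literature.MathematicalPhysics.KineticTheory.V3), v, w) * Literature.MathematicalPhysics.KineticTheory.hardSphereKernel (w, v) ω ∂Literature.MathematicalPhysics.KineticTheory.sphereMeasure = 0) → ∀ δ : ℝ, 0 < δ → ∃ N₀ : ℕ, ∀ N : ℕ, N₀ ≤ N → ∀ h : Fin (N + 1) → ℕ → ((Fin (N + 1) → (Fin 3 → ℤ) × Literature.MathematicalPhysics.KineticTheory.V3) × (Fin (N + 1) → (Fin 3 → ℤ) × Literature.MathematicalPhysics.KineticTheory.V3)) × Fin (N + 1) → ℝ, (∀ i n, Measurable (h i n)) → (∀ i n p, |h i n p| ≤ 1) → let ε := Literature.MathematicalPhysics.KineticTheory.hsDiameter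 σ N; let G : Literature.Analysis.FluidPDE.Geometry (Fin 3) Literature.MathematicalPhysics.KineticTheory.T3 := Literature.Analysis.FluidPDE.Torus.geometry (Fin 3); let q : Literature.MathematicalPhysics.KineticTheory.T3 → (Fin 3 → ℤ) := Literature.Analysis.FluidPDE.Torus.coarseCell r; let cnt : Literature.Analysis.FluidPDE.Config (N + 1) (Fin 3) Literature.MathematicalPhysics.KineticTheory.T3 → Fin (N + 1) → ℕ := fun z i => Set.ncard (Literature.Analysis.FluidPDE.collisionTimesOf G ε (fun t => (Φ N).flow t z) i ∩ Set.Ioc 0 τ); let c := fun (z : Literature.Analysis.FluidPDE.Config (N + 1) (Fin 3) Literature.MathematicalPhysics.KineticTheory.T3) (i : Fin (N + 1)) (n : ℕ) => (Φ N).nthRecordOf i n z; let S : Literature.Analysis.FluidPDE.Config (N + 1) (Fin 3) Literature.MathematicalPhysics.KineticTheory.T3 → ℝ := fun z => ε / (N + 1 : ℝ) * ∑ i : Fin (N + 1), ∑ n ∈ Finset.range (cnt z i), h i n ((Φ N).coarsePastOf q i n z, (Φ N).nthPartnerOf i n z) * g ((c z i n).impactVec, (c z i n).preVel.1, (c z i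 n).preVel.2); ∫⁻ z, ENNReal.ofReal |S z| ∂(Literature.MathematicalPhysics.KineticTheory.localGibbsLaw σ a₀ u₀ θ₀ N (Φ N)) ≤ ENNReal.ofReal δ

/-! ## §1 Surface measure: invariance under linear isometries, zero flux-mean of transverse tests -/

section Sphere

variable {E : Type*} [NormedAddCommGroup E] [InnerProductSpace ℝ E] [FiniteDimensional ℝ E]
  [MeasurableSpace E] [BorelSpace E]

/-- A linear isometry of the ambient space restricted to the unit sphere. [folklore] -/
def sphereMap (A : E ≃ₗᵢ[ℝ] E) (ω : sphere (0 : E) 1) : sphere (0 : E) 1 :=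
  ⟨A ω, by rw [mem_sphere_zero_iff_norm, A.norm_map, norm_eq_of_mem_sphere]⟩

omit [FiniteDimensional ℝ E] [MeasurableSpace E] [BorelSpace E] in
/-- The restricted isometry acts as the isometry on the underlying vectors. [folklore] -/
@[simp] theorem coe_sphereMap (A : E ≃ₗᵢ[ℝ] E) (ω : sphere (0 : E) 1) :
    (sphereMap A ω : E) = A ω := rfl

omit [FiniteDimensional ℝ E] [MeasurableSpace E] [BorelSpace E] in
/-- The restricted isometry is continuous. [folklore] -/
theorem continuous_sphereMap (A : E ≃ₗᵢ[ℝ] E) : Continuous (sphereMap A) :=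
  (A.continuous.comp continuous_subtype_val).subtype_mk _

omit [FiniteDimensional ℝ E] in
/-- The restricted isometry is measurable. [folklore] -/
theorem measurable_sphereMap (A : E ≃ₗᵢ[ℝ] E) : Measurable (sphereMap A) :=
  (continuous_sphereMap A).measurable

omit [FiniteDimensional ℝ E] [MeasurableSpace E] [BorelSpace E] in
/-- The restriction of `A` inverts the restriction of `A.symm`. [folklore] -/
theorem sphereMap_sphereMap_symm (A : E ≃ₗᵢ[ℝ] E) (η : sphere (0 : E) 1) :
    sphereMap A (sphereMap A.symm η) = η :=
  Subtype.ext (A.apply_symm_apply η)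

/-- **The surface measure of the unit sphere is invariant under linear isometries.** [folklore] -/
theorem sphereMeasure_map_sphereMap (A : E ≃ₗᵢ[ℝ] E) :
    (sphereMeasure : Measure (sphere (0 : E) 1)).map (sphereMap A) = sphereMeasure := by
  refine Measure.ext fun s hs => ?_
  rw [Measure.map_apply (measurable_sphereMap A) hs,
    Literature.MathematicalPhysics.KineticTheory.sphereMeasure,
    Measure.toSphere_apply' _ (measurable_sphereMap A hs), Measure.toSphere_apply' _ hs]
  congr 1
  have hset : (Ioo (0 : ℝ) 1 • (((↑) : sphere (0 : E) 1 → E) '' (sphereMap A ⁻¹' s))) =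
      A ⁻¹' (Ioo (0 : ℝ) 1 • (((↑) : sphere (0 : E) 1 → E) '' s)) := by
    ext x
    simp only [Set.mem_smul, Set.mem_image, Set.mem_preimage]
    constructor
    · rintro ⟨r, hr, y, ⟨ω, hω, rfl⟩, rfl⟩
      refine ⟨r, hr, (sphereMap A ω : E), ⟨sphereMap A ω, hω, rfl⟩, ?_⟩
      rw [coe_sphereMap, LinearIsometryEquiv.map_smul]
    · rintro ⟨r, hr, y, ⟨η, hη, rfl⟩, h⟩
      refine ⟨r, hr, (sphereMap A.symm η : E), ⟨sphereMap A.symm η, ?_, rfl⟩, ?_⟩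
      · show sphereMap A (sphereMap A.symm η) ∈ s
        rw [sphereMap_sphereMap_symm]; exact hη
      · apply A.injective
        rw [LinearIsometryEquiv.map_smul, coe_sphereMap, A.apply_symm_apply]
        exact h
  rw [hset]
  have hmap : (volume : Measure E).map A = volume := A.measurePreserving.map_eq
  have happ := MeasurableEquiv.map_apply (μ := (volume : Measure E))
    A.toHomeomorph.toMeasurableEquiv (Ioo (0 : ℝ) 1 • (((↑) : sphere (0 : E) 1 → E) '' s))
  rw [Homeomorph.toMeasurableEquiv_coe, LinearIsometryEquiv.coe_toHomeomorph, hmap] at happ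
  exact happ.symm

/-- The restricted isometry preserves the surface measure. [folklore] -/
theorem measurePreserving_sphereMap (A : E ≃ₗᵢ[ℝ] E) :
    MeasurePreserving (sphereMap A) (sphereMeasure : Measure (sphere (0 : E) 1)) sphereMeasure :=
  ⟨measurable_sphereMap A, sphereMeasure_map_sphereMap A⟩

/-- **Zero flux-mean of transverse linear kick tests.** For `c ⊥ b` the function
`ω ↦ ⟪ω, c⟫ · (⟪b, ω⟫)₊` integrates to zero over the unit sphere: the reflection in the
hyperplane `c^⊥` fixes `b`, flips `⟪ω, c⟫` and preserves the surface measure. [folklore] -/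
theorem integral_inner_mul_posPart_inner_eq_zero (b c : E) (hcb : ⟪c, b⟫_ℝ = 0) :
    ∫ ω : sphere (0 : E) 1, ⟪(ω : E), c⟫_ℝ * max ⟪b, (ω : E)⟫_ℝ 0 ∂sphereMeasure = 0 := by
  set A : E ≃ₗᵢ[ℝ] E := (ℝ ∙ c)ᗮ.reflection with hA
  have hAc : A c = -c := Submodule.reflection_orthogonalComplement_singleton_eq_neg c
  have hAb : A b = b := by
    apply Submodule.reflection_mem_subspace_eq_self
    rw [Submodule.mem_orthogonal_singleton_iff_inner_left]
    rwa [real_inner_comm]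
  set f : sphere (0 : E) 1 → ℝ := fun ω => ⟪(ω : E), c⟫_ℝ * max ⟪b, (ω : E)⟫_ℝ 0 with hf_def
  have hf : Continuous f :=
    (continuous_subtype_val.inner continuous_const).mul
      ((continuous_const.inner continuous_subtype_val).max continuous_const)
  have hodd : ∀ ω, f (sphereMap A ω) = -f ω := by
    intro ω
    have h1 : ⟪(A ω : E), c⟫_ℝ = -⟪(ω : E), c⟫_ℝ := by
      rw [← A.inner_map_map (A ω) c, Submodule.reflection_reflection, hAc, inner_neg_right]
    have h2 : ⟪b, (A ω : E)⟫_ℝ = ⟪b, (ω : E)⟫_ℝ := by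
      rw [← A.inner_map_map b (A ω), Submodule.reflection_reflection, hAb]
    simp only [hf_def, coe_sphereMap, h1, h2]
    ring
  have hmapint := integral_map (μ := (sphereMeasure : Measure (sphere (0 : E) 1)))
    (measurable_sphereMap A).aemeasurable (f := f) hf.aestronglyMeasurable
  rw [sphereMeasure_map_sphereMap] at hmapint
  have hneg : ∫ ω, f (sphereMap A ω) ∂sphereMeasure = -∫ ω, f ω ∂sphereMeasure := by
    simp_rw [hodd]
    exact integral_neg f
  change ∫ ω, f ω ∂sphereMeasure = 0
  linarith

end Sphere

/-! ## §2 The crux, repackaged (definitionally) -/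

/-- The type of the COARSE PAST handed to the weights `h i n`: the `r`-cells and exact velocities
of all `N + 1` spheres at the flight start of `i` (first snapshot) and at the flight start of its
partner (second snapshot), plus the partner's label. -/
abbrev Past (N : ℕ) : Type :=
  ((Fin (N + 1) → (Fin 3 → ℤ) × V3) × (Fin (N + 1) → (Fin 3 → ℤ) × V3)) × Fin (N + 1)

/-- The flow type of the crux at reduced density `σ` and size `N + 1`. -/
abbrev Flow (σ : ℝ) (N : ℕ) : Type :=
  HardSphereFlow (Literature.Analysis.FluidPDE.Torus.geometry (Fin 3)) (hsDiameter σ N) (N + 1)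

/-- **No vacuous escape.** At every reduced density `0 < σ < 1/2` flow families exist for ALL `N`
(Alexander's theorem on `𝕋³`, PROVED in the tree: `HardSphereFlow.nonempty_torus_holds`, with
`hsDiameter σ N ≤ σ < 1/2`), so the crux's `∀ Φ` and `H`'s `∃ Φ` range over a nonempty type: the crux
is neither vacuously true at small `σ` nor refutable by a junk flow (local Gibbs laws are absolutely
continuous w.r.t. the Liouville measure, which does not charge the complement of `Φ.good`). [folklore] -/
theorem nonempty_flow {σ : ℝ} (hσ : 0 < σ) (hσ2 : σ < 2⁻¹) : Nonempty ((N : ℕ) → Flow σ N) :=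
  ⟨fun N => Classical.choice (Literature.Analysis.FluidPDE.HardSphereFlow.nonempty_torus_holds (d := Fin 3)
    (Literature.MathematicalPhysics.KineticTheory.hsDiameter_pos hσ N)
    ((Literature.MathematicalPhysics.KineticTheory.hsDiameter_le hσ.le N).trans_lt hσ2) (N + 1))⟩

/-- The normalised weighted collision sum `S` of the crux (its `let`-chain, verbatim). -/
def kickSum (σ : ℝ) (N : ℕ) (Φ : Flow σ N) (τ r : ℝ) (g : V3 × V3 × V3 → ℝ)
    (h : Fin (N + 1) → ℕ → Past N → ℝ) (z : Config (N + 1) (Fin 3) T3) : ℝ :=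
  let ε := hsDiameter σ N
  let G : Literature.Analysis.FluidPDE.Geometry (Fin 3) T3 :=
    Literature.Analysis.FluidPDE.Torus.geometry (Fin 3)
  let q : T3 → (Fin 3 → ℤ) := Literature.Analysis.FluidPDE.Torus.coarseCell r
  let cnt : Config (N + 1) (Fin 3) T3 → Fin (N + 1) → ℕ := fun z i =>
    Set.ncard (collisionTimesOf G ε (fun t => Φ.flow t z) i ∩ Set.Ioc 0 τ)
  let c := fun (z : Config (N + 1) (Fin 3) T3) (i : Fin (N + 1)) (n : ℕ) => Φ.nthRecordOf i n z
  ε / (N + 1 : ℝ) * ∑ i : Fin (N + 1), ∑ n ∈ Finset.range (cnt z i),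
    h i n (Φ.coarsePastOf q i n z, Φ.nthPartnerOf i n z) *
      g ((c z i n).impactVec, (c z i n).preVel.1, (c z i n).preVel.2)

/-- The conclusion of the crux for given data: `‖S‖_{L¹(local Gibbs law)} ≤ δ`. -/
def KickBound (σ : ℝ) (a₀ θ₀ : T3 → ℝ) (u₀ : T3 → V3) (N : ℕ) (Φ : Flow σ N) (τ r : ℝ)
    (g : V3 × V3 × V3 → ℝ) (h : Fin (N + 1) → ℕ → Past N → ℝ) (δ : ℝ) : Prop :=
  ∫⁻ z, ENNReal.ofReal |kickSum σ N Φ τ r g h z| ∂(localGibbsLaw σ a₀ u₀ θ₀ N Φ) ≤ ENNReal.ofReal δ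

/-- Zero flux-mean on the incoming hemisphere, the normalisation of admissible kick tests. -/
def ZeroFluxMean (g : V3 × V3 × V3 → ℝ) : Prop :=
  ∀ v w : V3, ∫ ω : sphere (0 : V3) 1, g ((ω : V3), v, w) * hardSphereKernel (w, v) ω ∂sphereMeasure = 0

/-- **Faithful restatement.** `KickIsotropyInfo` with its `let`-chain packaged into `kickSum` /
`KickBound` (definitional unfolding). -/
theorem kickIsotropyInfo_iff :
    KickIsotropyInfo ↔
      ∀ (a₀ θ₀ : T3 → ℝ) (u₀ : T3 → V3), Continuous a₀ → Continuous θ₀ → Continuous u₀ →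
        (∀ x, 0 < a₀ x) → (∀ x, 0 < θ₀ x) → ∃ σ₀ : ℝ, 0 < σ₀ ∧ ∀ σ : ℝ, 0 < σ → σ < σ₀ →
        ∀ Φ : (N : ℕ) → Flow σ N, ∀ τ : ℝ, 0 < τ → ∀ r : ℝ, 0 < r →
        ∀ g : V3 × V3 × V3 → ℝ, Continuous g → (∃ C : ℝ, ∀ p, |g p| ≤ C) → ZeroFluxMean g →
        ∀ δ : ℝ, 0 < δ → ∃ N₀ : ℕ, ∀ N : ℕ, N₀ ≤ N →
        ∀ h : Fin (N + 1) → ℕ → Past N → ℝ, (∀ i n, Measurable (h i n)) → (∀ i n p, |h i n p| ≤ 1) →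
        KickBound σ a₀ θ₀ u₀ N (Φ N) τ r g h δ :=
  Iff.rfl

/-! ## §3 The shielding witness and its admissibility -/

/-- `c₁(v, w) = ‖w - v‖² v - ⟪v, w - v⟫ (w - v)`: `‖b‖²` times the component of `v` orthogonal to
the relative velocity `b = w - v` (a polynomial, hence continuous, field with `c₁ ⊥ b`). -/
def perpVel (v w : V3) : V3 := (‖w - v‖ ^ 2) • v - ⟪v, w - v⟫_ℝ • (w - v)

/-- `perpVel v w` is orthogonal to the relative velocity `w - v`. [folklore] -/
theorem inner_perpVel_sub (v w : V3) : ⟪perpVel v w, w - v⟫_ℝ = 0 := by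
  have h : ‖w - v‖ ^ 2 = ⟪w, w - v⟫_ℝ - ⟪v, w - v⟫_ℝ := by
    rw [← real_inner_self_eq_norm_sq, inner_sub_left]
  simp only [perpVel, inner_sub_left, real_inner_smul_left, h]
  ring

/-- `perpVel` is (jointly) continuous. [folklore] -/
theorem continuous_perpVel : Continuous fun p : V3 × V3 => perpVel p.1 p.2 := by
  unfold perpVel
  fun_prop

/-- The shielding kick test with transverse field `c` and regularisation `κ`:
`g(ω, v, w) = ⟪ω, c(v,w)⟫ / ((κ + ‖c(v,w)‖)(1 + ‖ω‖²))` — on the unit sphere a positive multiple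
(depending on `(v, w)` only) of the transverse coordinate `⟪ω, c(v,w)⟫`; globally bounded by `1`. -/
def kickTest (c : V3 → V3 → V3) (κ : ℝ) (p : V3 × V3 × V3) : ℝ :=
  ⟪p.1, c p.2.1 p.2.2⟫_ℝ / ((κ + ‖c p.2.1 p.2.2‖) * (1 + ‖p.1‖ ^ 2))

/-- The kick test is continuous for a continuous field and `κ > 0`. [folklore] -/
theorem continuous_kickTest {c : V3 → V3 → V3} (hc : Continuous fun p : V3 × V3 => c p.1 p.2)
    {κ : ℝ} (hκ : 0 < κ) : Continuous (kickTest c κ) := by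
  unfold kickTest
  have hc' : Continuous fun p : V3 × V3 × V3 => c p.2.1 p.2.2 :=
    hc.comp (continuous_snd.fst.prodMk continuous_snd.snd)
  refine (continuous_fst.inner hc').div ((continuous_const.add hc'.norm).mul
    (continuous_const.add (continuous_fst.norm.pow 2))) fun p => ?_
  have h1 : 0 < κ + ‖c p.2.1 p.2.2‖ := by positivity
  have h2 : 0 < 1 + ‖p.1‖ ^ 2 := by positivity
  positivity

/-- The kick test is bounded by `1` (for `κ > 0`). [folklore] -/
theorem abs_kickTest_le_one (c : V3 → V3 → V3) {κ : ℝ} (hκ : 0 < κ) (p : V3 × V3 × V3) :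
    |kickTest c κ p| ≤ 1 := by
  unfold kickTest
  set x := c p.2.1 p.2.2
  have hden : 0 < (κ + ‖x‖) * (1 + ‖p.1‖ ^ 2) := by positivity
  rw [abs_div, abs_of_pos hden, div_le_one hden]
  have h1 : |⟪p.1, x⟫_ℝ| ≤ ‖p.1‖ * ‖x‖ := abs_real_inner_le_norm _ _
  nlinarith [norm_nonneg p.1, norm_nonneg x, sq_nonneg (‖p.1‖ - 1),
    mul_nonneg (norm_nonneg x) (sq_nonneg (‖p.1‖ - 1))]

/-- **The kick test has zero flux-mean** for every transverse field (`c(v,w) ⊥ w - v`). -/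
theorem zeroFluxMean_kickTest {c : V3 → V3 → V3} (hc : ∀ v w, ⟪c v w, w - v⟫_ℝ = 0) (κ : ℝ)
    (v w : V3) :
    ∫ ω : sphere (0 : V3) 1, kickTest c κ ((ω : V3), v, w) * hardSphereKernel (w, v) ω
      ∂sphereMeasure = 0 := by
  have hker : ∀ ω : sphere (0 : V3) 1, hardSphereKernel (w, v) ω = max ⟪w - v, (ω : V3)⟫_ℝ 0 :=
    fun ω => rfl
  have hg : ∀ ω : sphere (0 : V3) 1, kickTest c κ ((ω : V3), v, w) * hardSphereKernel (w, v) ω =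
      (1 / ((κ + ‖c v w‖) * (1 + (1 : ℝ) ^ 2))) *
        (⟪(ω : V3), c v w⟫_ℝ * max ⟪w - v, (ω : V3)⟫_ℝ 0) := by
    intro ω
    rw [hker, kickTest]
    simp only [norm_eq_of_mem_sphere]
    ring
  simp_rw [hg, integral_const_mul, integral_inner_mul_posPart_inner_eq_zero (w - v) (c v w) (hc v w),
    mul_zero]

/-- `‖d‖⁻¹ d` (junk `0` at `d = 0`). -/
def unitVec (d : V3) : V3 := ‖d‖⁻¹ • d

/-- `unitVec` is measurable. [folklore] -/
theorem measurable_unitVec : Measurable unitVec :=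
  (measurable_norm.inv).smul measurable_id

/-- **The shielding direction read off the TYPED coarse past.** With `V¹ = p.1.1` (cells and exact
velocities of all spheres at the flight start of `i`), `V² = p.1.2` (the same at the flight start
of the partner) and `j = p.2` (the partner's label): `e(p) = unit(V²_j - V¹_j) - unit(V¹_i - V²_i)`.
Case B (partner kicked last, `V¹_j ≠ V²_j`): `+unit(w - w₁)`, the direction from the partner's
previous partner to the partner at their contact; case A (`i` kicked last, `V¹_i ≠ V²_i`):
`-unit(v - v₁)`. In either case the third body forbids the cap `⟪ω, e⟫ < -1/2` of impact vectors
while it is still adjacent (flight of length `≲ ε`), biasing `ω` towards `+e`. -/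
def shieldDir (N : ℕ) (i : Fin (N + 1)) (p : Past N) : V3 :=
  unitVec ((p.1.2 p.2).2 - (p.1.1 p.2).2) - unitVec ((p.1.1 i).2 - (p.1.2 i).2)

/-- **The shielding weight**: `h_i(p) = clamp_{[-1,1]}(K ⟪e(p), c(v(p), w(p))⟫)`, `v(p) = V¹_i`,
`w(p) = V²_j` the pre-collisional velocities of `i` and of its partner as read off the past. -/
def shieldWeight (c : V3 → V3 → V3) (K : ℝ) (N : ℕ) (i : Fin (N + 1)) (_n : ℕ) (p : Past N) : ℝ :=
  max (-1) (min 1 (K * ⟪shieldDir N i p, c (p.1.1 i).2 (p.1.2 p.2).2⟫_ℝ))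

/-- The shielding weight is bounded by `1` (it is clamped). [folklore] -/
theorem abs_shieldWeight_le_one (c : V3 → V3 → V3) (K : ℝ) (N : ℕ) (i : Fin (N + 1)) (n : ℕ)
    (p : Past N) : |shieldWeight c K N i n p| ≤ 1 :=
  abs_le.2 ⟨le_max_left _ _, max_le (by norm_num) (min_le_left _ _)⟩

/-- The shielding weight is measurable on the typed past (product σ-algebra; the label factor is
countable). [folklore] -/
theorem measurable_shieldWeight {c : V3 → V3 → V3} (hc : Continuous fun p : V3 × V3 => c p.1 p.2)
    (K : ℝ) (N : ℕ) (i : Fin (N + 1)) (n : ℕ) : Measurable (shieldWeight c K N i n) := by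
  unfold shieldWeight shieldDir
  refine measurable_from_prod_countable_left fun j => ?_
  simp only
  have hv : ∀ k : Fin (N + 1), Measurable fun x : (Fin (N + 1) → (Fin 3 → ℤ) × V3) ×
      (Fin (N + 1) → (Fin 3 → ℤ) × V3) => (x.1 k).2 := fun k =>
    ((measurable_pi_apply k).comp measurable_fst).snd
  have hw : ∀ k : Fin (N + 1), Measurable fun x : (Fin (N + 1) → (Fin 3 → ℤ) × V3) ×
      (Fin (N + 1) → (Fin 3 → ℤ) × V3) => (x.2 k).2 := fun k =>
    ((measurable_pi_apply k).comp measurable_snd).snd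
  have he : Measurable fun x : (Fin (N + 1) → (Fin 3 → ℤ) × V3) ×
      (Fin (N + 1) → (Fin 3 → ℤ) × V3) =>
      unitVec ((x.2 j).2 - (x.1 j).2) - unitVec ((x.1 i).2 - (x.2 i).2) :=
    (measurable_unitVec.comp ((hw j).sub (hv j))).sub (measurable_unitVec.comp ((hv i).sub (hw i)))
  have hcm : Measurable fun x : (Fin (N + 1) → (Fin 3 → ℤ) × V3) ×
      (Fin (N + 1) → (Fin 3 → ℤ) × V3) => c (x.1 i).2 (x.2 j).2 :=
    hc.measurable.comp ((hv i).prodMk (hw j))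
  exact measurable_const.max (measurable_const.min (measurable_const.mul (he.inner hcm)))

/-! ## §4 `H` and the negative lemma `H → ¬ KickIsotropyInfo` -/

/-- The crux specialised to the INVARIANT Gibbs law (constant profiles `a₀ = θ₀ = 1`, `u₀ = 0`) —
the weakest instance, and the one the shielding witness attacks. -/
def KickFairAtEquilibrium : Prop :=
  ∃ σ₀ : ℝ, 0 < σ₀ ∧ ∀ σ : ℝ, 0 < σ → σ < σ₀ → ∀ Φ : (N : ℕ) → Flow σ N, ∀ τ : ℝ, 0 < τ →
    ∀ r : ℝ, 0 < r → ∀ g : V3 × V3 × V3 → ℝ, Continuous g → (∃ C : ℝ, ∀ p, |g p| ≤ C) →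
    ZeroFluxMean g → ∀ δ : ℝ, 0 < δ → ∃ N₀ : ℕ, ∀ N : ℕ, N₀ ≤ N →
    ∀ h : Fin (N + 1) → ℕ → Past N → ℝ, (∀ i n, Measurable (h i n)) → (∀ i n p, |h i n p| ≤ 1) →
    KickBound σ (fun _ => 1) (fun _ => 1) (fun _ => 0) N (Φ N) τ r g h δ

/-- `KickIsotropyInfo` contains its equilibrium instance. -/
theorem kickFairAtEquilibrium_of_kickIsotropyInfo (hK : KickIsotropyInfo) : KickFairAtEquilibrium :=
  (kickIsotropyInfo_iff.1 hK) (fun _ => 1) (fun _ => 1) (fun _ => 0) continuous_const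
    continuous_const continuous_const (fun _ => one_pos) (fun _ => one_pos)

/-- **`H`: third-body shielding memory persists (the dynamical inequality the MD certifies).** For
every `σ₀` there are `σ < σ₀`, a flow family, a horizon, a cell size, a continuous transverse field
`c` (`c(v,w) ⊥ w - v`), constants `κ > 0`, `K`, and `δ > 0` such that for infinitely many `N` the
`L¹(invariant Gibbs law)` norm of the shielding collision sum
`kickSum … (kickTest c κ) (shieldWeight c K N)` EXCEEDS `δ`. Mechanism: the two velocity snapshots of
the typed past reveal the direction `u` of the last kick received by whichever partner started its
flight later; its previous partner sits at distance `ε` in direction `-u`, and while that flight is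
shorter than `≈ ε` (probability `≈ √2 π σ³`, independent of `N`) hard-core exclusion EMPTIES the cap
`⟪ω, e⟫ < -1/2` of impact vectors (`Negative/ShieldedCapGeometry.lean`); nothing refills it at leading
order, so `E S_N → εΓτ · T ≠ 0` with `εΓ = 4√π σ³ g₂` and `T ≈ 0.26 σ³` (kit j004861: `T = +0.0178(4)`
at `φ = 0.05`, N-independent, `N = 256…2048`; cartoon j005475). NOT CONSTRUCTIBLE in the tree today:
no collision-rate / Palm identity for the `N`-body flow, no three-body contact formula.
[topic MathematicalPhysics/KineticTheory] -/
def ShieldingBiasPersists : Prop :=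
  ∀ σ₀ : ℝ, 0 < σ₀ → ∃ σ : ℝ, 0 < σ ∧ σ < σ₀ ∧ ∃ Φ : (N : ℕ) → Flow σ N, ∃ τ : ℝ, 0 < τ ∧
    ∃ r : ℝ, 0 < r ∧ ∃ c : V3 → V3 → V3, (Continuous fun p : V3 × V3 => c p.1 p.2) ∧
    (∀ v w, ⟪c v w, w - v⟫_ℝ = 0) ∧ ∃ κ : ℝ, 0 < κ ∧ ∃ K : ℝ, ∃ δ : ℝ, 0 < δ ∧
    ∀ N₀ : ℕ, ∃ N : ℕ, N₀ ≤ N ∧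
      ¬ KickBound σ (fun _ => 1) (fun _ => 1) (fun _ => 0) N (Φ N) τ r (kickTest c κ)
        (shieldWeight c K N) δ

/-- **A persistent shielding bias kills the equilibrium instance** (the witnesses are admissible by
§3, so the crux's bound would apply to them). -/
theorem kickFairAtEquilibrium_false_of_shieldingBiasPersists (H : ShieldingBiasPersists) :
    ¬ KickFairAtEquilibrium := by
  rintro ⟨σ₀, hσ₀, hall⟩
  obtain ⟨σ, hσ, hσσ₀, Φ, τ, hτ, r, hr, c, hc, hcb, κ, hκ, K, δ, hδ, hN⟩ := H σ₀ hσ₀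
  obtain ⟨N₀, hN₀⟩ := hall σ hσ hσσ₀ Φ τ hτ r hr (kickTest c κ) (continuous_kickTest hc hκ)
    ⟨1, abs_kickTest_le_one c hκ⟩ (fun v w => zeroFluxMean_kickTest hcb κ v w) δ hδ
  obtain ⟨N, hle, hnot⟩ := hN N₀
  exact hnot (hN₀ N hle (shieldWeight c K N) (fun i n => measurable_shieldWeight hc K N i n)
    (fun i n p => abs_shieldWeight_le_one c K N i n p))

/-- **NEGATIVE LEMMA MODULO `H = ShieldingBiasPersists`: `H → ¬ KickIsotropyInfo`.** -/
theorem KickIsotropyInfo_false_of_ShieldingBiasPersists (H : ShieldingBiasPersists) :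
    ¬ KickIsotropyInfo := fun hK =>
  kickFairAtEquilibrium_false_of_shieldingBiasPersists H (kickFairAtEquilibrium_of_kickIsotropyInfo hK)

end

end Summit.AtomisticToContinuum.HydrodynamicLimit.Theorems.KickIsotropyInfoNegative
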